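import Mathlib
import HarnessLib
import Summits.NavierStokesRegularity.NavierStokesRegularity.Theorems.PoloidalWindowDoorLrcModEntireTwistingTHLocalGalilean

/-!
# Route `PoloidalWindowDoor`, crux `PoloidalWindowRigidity` (stmt-19708) / item `LrcModEntire` (stmt-20428), line `sparse_energy` —
# the SOURCE-FREE datum after the Galilean boost, in REST-FRAME variables (sign of the `c₂²` term, kernel-checked)

Seat ns-poloidal-K2-p2 g9 (successor of the interim LEAD-of-record on 19708; file `--supports`).  On K-sparse profiles the (TH)∩twisting
datum is source-free in the ORIGINAL frame (`…SparseEnergySourceFreeDatum`, `…TwistingTHSparse`: `A ≡ 0`).  The Galilean boost to the rest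
point `u(p₀) = 0` (`…TwistingTHLocalGalilean.galilean_E`, boost velocity `c`, `k = c₂`) turns the A-slot of the scalar law E into
`[A + c₂(∂ₜμ − ∂_z²μ) + (c₂²/2)∂_zμ](s, ζ + (s−t₀)c₂)` — written in the ORIGINAL slope `μ` at the sheared height.  For the rest-frame normal
forms (`hemptyHypNUG…RS`, twist_split v4.4) and for the engines' letters the datum must be expressed in the BOOSTED slope
`μ′(s,ζ) := μ(s, ζ + (s−t₀)c₂)` (the datum's own `μ` after the boost).  Since `∂ₜμ′ = ∂ₜμ + c₂∂_zμ`, `∂_zμ′ = ∂_zμ`, `∂_z²μ′ = ∂_z²μ`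
(`deriv_boostSlope_time`, `deriv_boostSlope`, `deriv_deriv_boostSlope`), the source-free datum reads, IN REST-FRAME VARIABLES,

  `A′ = c₂(∂ₜμ′ − ∂_z²μ′) − (c₂²/2)∂_zμ′`   — the `c₂²` term carries a MINUS sign

(`boostedDatum_eq`; letters: `a_j = c₂(n′_j − (j+2)(j+1)m_{j+2}) − (c₂²/2)(j+1)m_{j+1}` with `n′` the rest-frame `μ_t` coefficients).  The two
one-parameter families `c(∂ₜμ − ∂_z²μ) ± (c²/2)∂_zμ` are NOT related by `c ↦ −c`, so the sign is load-bearing for any stub text / certificate.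

WHAT THIS IS NOT: not a claim about Navier–Stokes — one-variable chain-rule bookkeeping for the v4.4 stub text (bears_on LADDER-NS N0 via 19708/20428).
[folklore]
-/

noncomputable section

-- the summit and its single sub-problem share the name (CONVENTIONS §1), as in every Theorems file
set_option linter.dupNamespace false

namespace Summit.NavierStokesRegularity.NavierStokesRegularity.Theorems.PoloidalWindowDoorLrcModEntireTwistingTHSparseBoost

open Set Function
open Summit.NavierStokesRegularity.NavierStokesRegularity.Theorems.PoloidalWindowDoorLrcModEntireTwistingTHLocalGalilean

/-- **The source-free datum after the Galilean boost, in rest-frame variables.**  With `μ′(s,ζ) = μ(s, ζ + (s−t₀)k)` the A-slot of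
`galilean_E` for `A ≡ 0`, namely `k(∂ₜμ − ∂_z²μ) + (k²/2)∂_zμ` at the sheared height (LEFT side, original slope), equals
`k(∂ₜμ′ − ∂_z²μ′) − (k²/2)∂_zμ′` at `(t,z)` (RIGHT side, boosted slope). [folklore] -/
theorem boostedDatum_eq (μ : ℝ → ℝ → ℝ) (t₀ k : ℝ) {t z : ℝ}
    (hμ : DifferentiableAt ℝ (uncurry μ) (t, z + (t - t₀) * k)) :
    k * (deriv (fun s => μ s (z + (t - t₀) * k)) t - deriv (deriv (μ t)) (z + (t - t₀) * k)) +
        k ^ 2 / 2 * deriv (μ t) (z + (t - t₀) * k) =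
      k * (deriv (fun s => μ s (z + (s - t₀) * k)) t - deriv (deriv (fun ζ => μ t (ζ + (t - t₀) * k))) z) -
        k ^ 2 / 2 * deriv (fun ζ => μ t (ζ + (t - t₀) * k)) z := by
  rw [deriv_boostSlope_time μ t₀ k hμ, deriv_boostSlope, deriv_deriv_boostSlope]
  ring

/-- The same identity read from right to left with the boosted slope as the primary object: for `μ′` the boosted slope and
`μ(s,ζ) = μ′(s, ζ − (s−t₀)k)` its un-boost, the rest-frame datum `k(∂ₜμ′ − ∂_z²μ′) − (k²/2)∂_zμ′` is what the original-frame expression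
`k(∂ₜμ − ∂_z²μ) + (k²/2)∂_zμ` becomes — stated here as the special case `A = 0` of the A-slot of `galilean_E` (pure rewriting of
`boostedDatum_eq`; recorded for citation by the v4.4 stub text). [folklore] -/
theorem restFrameDatum_of_sourceFree (μ : ℝ → ℝ → ℝ) (t₀ k : ℝ) {t z : ℝ} (A : ℝ → ℝ → ℝ) (hA : A t (z + (t - t₀) * k) = 0)
    (hμ : DifferentiableAt ℝ (uncurry μ) (t, z + (t - t₀) * k)) :
    A t (z + (t - t₀) * k) +
        k * (deriv (fun s => μ s (z + (t - t₀) * k)) t - deriv (deriv (μ t)) (z + (t - t₀) * k)) +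
        k ^ 2 / 2 * deriv (μ t) (z + (t - t₀) * k) =
      k * (deriv (fun s => μ s (z + (s - t₀) * k)) t - deriv (deriv (fun ζ => μ t (ζ + (t - t₀) * k))) z) -
        k ^ 2 / 2 * deriv (fun ζ => μ t (ζ + (t - t₀) * k)) z := by
  rw [hA, zero_add]
  exact boostedDatum_eq μ t₀ k hμ

end Summit.NavierStokesRegularity.NavierStokesRegularity.Theorems.PoloidalWindowDoorLrcModEntireTwistingTHSparseBoost

end
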